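import Summits.QuantumFields.BalabanUV.Beta.D1BFx.CoframeWordShapes

/-!
# `BalabanUV.Beta.D1BFx.CoframeWordPieces` — road «BF-x» for binder row D1, slot (K), (II)-row (C2) «TB4-W CO-FRAME TABLE, m-UNIFORM MASS», FILE δ1b
# «COFRAME PIECES»: **EVERY PIECE OF A P4b WORD IS A VERTEX SANDWICH** — a localised vertex seen through a leg on its far side stays localised
# (`cols_comp_left`), two touching vertices (`totMass_touch`), and the four piece shapes «opposite sides» ∕ «same side» ∕ «two weights around a leg» ∕
# «one summable weight on a leg», each with ONE `Zl 4 (κ−θ)` and the separation factor `e^{−θ|c−c′|₁}` (count half of (C2), ρ-g19-1 AMENDED l.43347)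

HONEST DEPENDENCY (cell records, verbatim): «continuum YM on T⁴ ⇐ BetaPertH ∧ nine spine estimates (0/9 proved); BetaPertH ⇐ (D1) ∧ (D4) ∧
CAP+tail; G-an2-4 gates asym, D1 and NE2/3/4.»  HONEST FRAMING (cell contract, verbatim): «discharging `BetaPertH` makes Bałaban's UV stability
UNCONDITIONAL — a real constructive-QFT result; it is NOT the continuum limit and NOT the Clay problem.»  THIS MODULE DISCHARGES NOTHING of the
wall: [folklore] `ℓ¹` bookkeeping (one column of a kernel as a graph-supported kernel, α2's `totMass_comp_left ∕ totMass_sandwich`, the identity kernel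
`HessKerSchurResolvent.idK`) over α1∕α2's predicates `RowMass ∕ ColMass ∕ TotMass`, on `Site 4 = ℤ⁴` with `Unit` fibre.  No definition,
no `def … : Prop`, nothing cited, 0 sorry.  0 root-level binders of row D1 discharged (hW ∕ hR-sockets ∕ hSX-socket ∕ D1Tel ∕ D1Rep = 0); (K) NOT closed;
(C1)(C2) NOT closed here; NOT D1, NOT `BetaPertH`, NOT continuum, NOT Clay.

ABSOLUTE RULE (cell charter, verbatim): «No internally-minted statement may enter as a cited fact. Every hypothesis is either kernel-proved in
this package or a verbatim quotation of a PUBLISHED theorem with page reference. The manuscript(s) under audit are NOT citable for their own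
disputed steps — they are the thing under adjudication; programme-internal (2001/route/tribunal) claims are never citable.»

WHY.  With δ1's reduction of `dSw ∕ jetCw ∕ jetRw ∕ jetRCw` to pieces, the (C2) count of a word is: (outer legs, `totMass_comp_left∕right`) ∘ (a piece).
A piece `x z ↦ ω z·(V∘B)(x+s, z+t)` IS the composition `V_s ∘ B_t ∘ diag ω` (δ1 `mul_diag_right`), i.e. α2's sandwich with the diagonal kernel of the
weight as the second vertex; the weight next to its own vertex is the sandwich with the identity leg.  The vertex of a word may carry an outer leg on its
far side (`lapU∘Cgh ∘ gW w`): `cols_comp_left` shows its columns stay localised with amplitude `× c_A` (one column at a time through `totMass_comp_left`).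

CONTENT (all [folklore]; `D = 4`, `Unit` fibre; `0 ≤ θ < κ`; «columns of `V` localised at `c`» = `∀ y, Summable ∧ Σ'_u rowFn V 0 u y ≤ ω_V·e^{−κ|y−c|₁}`).
* §1 `totMass_colSel`, `comp_colSel`, **`cols_comp_left`** (`ColMass A 0 c_A` ⟹ columns of `A∘V` localised with `c_A·Φ`).
* §2 `rowMass_idK`, **`totMass_touch`** (`TotMass (V∘V′) (ω_V·ω_{V′}·Zl 4 (κ−θ)·e^{−θ|c−c′|₁})`), **`totMass_piece_opp`**
  (`TotMass (x z ↦ ω z·(V∘B)(x+s,z+t)) (ω_V·Ω·(e^{θ|t|₁}·M_B)·Zl 4 (κ−θ)·e^{−θ|c−c′|₁})`), **`totMass_piece_same`**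
  (`TotMass (x z ↦ ω z·V (x+s) (z+t)) (ω_V·e^{κ|t|₁}·Ω·Zl 4 (κ−θ)·e^{−θ|c−c′|₁})`), **`totMass_piece_rc`**
  (`TotMass (x z ↦ ω x·ω′ z·B (x+s) (z+t)) (Ω·Ω′·(e^{θ|t|₁}·(e^{θ|s|₁}·M_B))·Zl 4 (κ−θ)·e^{−θ|c−c′|₁})`), **`totMass_piece_summable`**
  (`ColMass B 0 c_B`, `Σ'|ϖ| < ∞` ⟹ `TotMass (x z ↦ ϖ z·B (x+s) (z+t)) (c_B·Σ'|ϖ|)`).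
NOT HERE: the vertices `gW ∕ d2W` (δ2 `CoframeVertices`), the sixteen words and `cofPairInf` (δ3).
Unit `b2b-balaban-gan24-formalise-leaf-05` (gen 54), G-an2-4 swarm leaf prover 05, road «BF-x» (C1)(C2) count owner; INTENT «COFRAME SHAPES» (journal).
-/


noncomputable section

namespace Summit.QuantumFields.BalabanUV.Beta.D1BFx.CoframeWordPieces

open scoped BigOperators
open Finset
open Literature.MathematicalPhysics.QuantumFieldTheory.Balaban1983to89
open Literature.MathematicalPhysics.QuantumFieldTheory.Balaban1983to89.Beta
open B12Sec2to5 (l1 l1_nonneg)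
open ExpKernelCalculus (Site MKer comp Zl Zl_pos l1_sub_triangle l1_sub_symm summable_exp_shift' tsum_exp_shift')
open AffineAveraging (unitVec)
open OneStepResolventKernel (wsum)
open Summit.QuantumFields.BalabanUV.Beta.TameKernelCalculus (trK trK_trK)
open Summit.QuantumFields.BalabanUV.Beta.D1BFx.RJetAssembly (dSw)
open Summit.QuantumFields.BalabanUV.Beta.D1BFx.PackedPinnedLetters (jetRw jetCw jetRCw)
open Summit.QuantumFields.BalabanUV.Beta.D1BFx.GhostStencil (ghCur ghCur_apply l1_unitVec l1_zero)
open Summit.QuantumFields.BalabanUV.Beta.D1BFx.PackedCoframeSiteWords (gW)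
open Summit.QuantumFields.BalabanUV.Beta.D1BFx.KernelMassCalculus
open Summit.QuantumFields.BalabanUV.Beta.D1BFx.KernelMassTotal
open Summit.QuantumFields.BalabanUV.Beta.D1BFx.CoframeWordShapes

/-! ## §1 A localised vertex through a leg on its far side -/

section Through

variable {A V : MKer 4 Unit} {cA rA ρ : ℝ} {Φ : Site 4 → ℝ}

/-- [folklore] One column of a kernel as a kernel: its total mass is that column's sum. -/
theorem totMass_colSel (y₀ : Site 4) {S : ℝ} (h : (Summable fun x => rowFn V 0 x y₀) ∧ ∑' x, rowFn V 0 x y₀ ≤ S) :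
    TotMass (fun x y (a b : Unit) => if y = y₀ then V x y a b else 0) S := by
  set f : Site 4 × Site 4 → ℝ := fun p => ∑ a : Unit, ∑ b : Unit,
    |(fun x y (a b : Unit) => if y = y₀ then V x y a b else (0 : ℝ)) p.1 p.2 a b| with hf
  have hg : Function.Injective fun x : Site 4 => (x, y₀) := fun x y h => (Prod.mk.inj h).1
  have hfg : f ∘ (fun x : Site 4 => (x, y₀)) = fun x => rowFn V 0 x y₀ := by
    funext x; simp [hf, rowFn_zero]
  have hzero : ∀ p, p ∉ Set.range (fun x : Site 4 => (x, y₀)) → f p = 0 := by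
    rintro ⟨x, y⟩ hp
    have hy : y ≠ y₀ := fun h' => hp ⟨x, by rw [h']⟩
    simp [hf, hy]
  have hsum : HasSum f (∑' x, rowFn V 0 x y₀) := by
    have h1 : HasSum (f ∘ fun x : Site 4 => (x, y₀)) (∑' x, rowFn V 0 x y₀) := by rw [hfg]; exact h.1.hasSum
    exact (hg.hasSum_iff hzero).1 h1
  exact ⟨hsum.summable, hsum.tsum_eq.le.trans h.2⟩

/-- [folklore] Selecting a column commutes with composition on the left. -/
theorem comp_colSel (y₀ : Site 4) :
    comp A (fun x y (a b : Unit) => if y = y₀ then V x y a b else 0) = fun x y (a b : Unit) => if y = y₀ then comp A V x y a b else 0 := by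
  funext x y a b
  unfold ExpKernelCalculus.comp
  by_cases h : y = y₀
  · simp only [h, if_true]
  · simp [h]

/-- [folklore] **A LEG ON THE FAR SIDE KEEPS THE COLUMNS LOCALISED**: `ColMass A 0 c_A` and columns of `V` with sums `≤ Φ y` ⟹ the columns of
`A ∘ V` have sums `≤ c_A·Φ y` (one column at a time: the selected column is a kernel of total mass `Φ y`, and `totMass_comp_left`). -/
theorem cols_comp_left (hA : ColMass A 0 cA) (hV : ∀ y, (Summable fun x => rowFn V 0 x y) ∧ ∑' x, rowFn V 0 x y ≤ Φ y) (y : Site 4) :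
    (Summable fun x => rowFn (comp A V) 0 x y) ∧ ∑' x, rowFn (comp A V) 0 x y ≤ cA * Φ y := by
  have h1 := totMass_comp_left hA (totMass_colSel y (hV y))
  rw [comp_colSel] at h1
  obtain ⟨hs, hle⟩ := totMass_colMass h1 y
  have e : (fun x => rowFn (fun x y' (a b : Unit) => if y' = y then comp A V x y' a b else 0) 0 x y) = fun x => rowFn (comp A V) 0 x y := by
    funext x; simp [rowFn]
  rw [e] at hs hle
  exact ⟨hs, hle⟩

end Through

/-! ## §2 Two vertices: touching, or around a leg — the pieces of the jet words -/

section Pieces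

open HessKerSchurResolvent (idK idK_apply comp_idK_right)

variable {V V' B : MKer 4 Unit} {ωV ωV' κ θ ρ γ MB : ℝ} {c c' : Site 4}

/-- [folklore] The identity kernel has θ-row mass `1` (`Unit` fibre). -/
theorem rowMass_idK (θ : ℝ) : RowMass (idK : MKer 4 Unit) θ 1 := by
  intro x
  have e : rowFn (idK : MKer 4 Unit) θ x = fun y => if x = y then (1 : ℝ) else 0 := by
    funext y
    rw [rowFn, fib_unit, idK_apply]
    by_cases h : x = y
    · subst h; simp [l1_zero]
    · rw [if_neg (fun h' => h h'.1), if_neg h, abs_zero, zero_mul]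
  rw [e]
  exact ⟨(hasSum_ite_eq' x (1 : ℝ)).summable, ((hasSum_ite_eq' x (1 : ℝ)).tsum_eq).le⟩

/-- [folklore] **TWO TOUCHING VERTICES**: `V` with columns localised at `c` (`Σ'_u rowFn V 0 u y ≤ ω·e^{−κ|y−c|₁}`) composed with `V′` with rows
localised at `c′`, `0 ≤ θ < κ`: `TotMass (V ∘ V′) (ω·ω′·Zl 4 (κ−θ)·e^{−θ|c−c′|₁})` (the sandwich with the identity leg). -/
theorem totMass_touch (hVrow : RowMass V 0 ρ) (hVcol : ∀ y, (Summable fun u => rowFn V 0 u y) ∧ ∑' u, rowFn V 0 u y ≤ ωV * Real.exp (-κ * l1 (y - c)))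
    (hθ : 0 ≤ θ) (hθκ : θ < κ)
    (hV'col : ColMass V' 0 γ) (hV'row : ∀ v, Summable (rowFn V' 0 v) ∧ ∑' v', rowFn V' 0 v v' ≤ ωV' * Real.exp (-κ * l1 (v - c'))) :
    TotMass (comp V V') (ωV * ωV' * Zl 4 (κ - θ) * Real.exp (-θ * l1 (c - c'))) := by
  have h := totMass_sandwich hVrow hVcol (rowMass_idK θ) hθ hθκ hV'col hV'row
  rw [comp_idK_right, mul_one] at h
  exact h

variable {ω : Site 4 → ℝ} {Ω : ℝ}

/-- [folklore] **PIECE «OPPOSITE SIDES»** (the pieces of `jetCw ω (Ṽ ∘ B)`): a vertex `V` (columns localised at `c`), a leg `B` (`RowMass B θ M_B`), and a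
column weight `ω` localised at `c′` on the far side: `TotMass (x z ↦ ω z·(V ∘ B)(x+s, z+t)) (ω_V·Ω·(e^{θ|t|₁}·M_B)·Zl 4 (κ−θ)·e^{−θ|c−c′|₁})`. -/
theorem totMass_piece_opp (hVrow : RowMass V 0 ρ)
    (hVcol : ∀ y, (Summable fun u => rowFn V 0 u y) ∧ ∑' u, rowFn V 0 u y ≤ ωV * Real.exp (-κ * l1 (y - c)))
    (hB : RowMass B θ MB) (hθ : 0 ≤ θ) (hθκ : θ < κ)
    (hω : ∀ z, |ω z| ≤ Ω * Real.exp (-κ * l1 (z - c'))) (s t : Site 4) :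
    TotMass (fun x z (_ _ : Unit) => ω z * comp V B (x + s) (z + t) () ())
      (ωV * Ω * (Real.exp (θ * l1 t) * MB) * Zl 4 (κ - θ) * Real.exp (-θ * l1 (c - c'))) := by
  have hκ : 0 ≤ κ := hθ.trans hθκ.le
  -- the piece as a composition `V_s ∘ B_t ∘ diag ω`
  have e : (fun x z (_ _ : Unit) => ω z * comp V B (x + s) (z + t) () ())
      = comp (comp (fun x y (a b : Unit) => V (x + s) y a b) (fun y z (a b : Unit) => B y (z + t) a b))
          (fun x z (_ _ : Unit) => if x = z then ω x else 0) := by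
    rw [← mul_diag_right]
    funext x z a b
    rw [mul_comm]
    rfl
  rw [e]
  have hVs_row : RowMass (fun x y (a b : Unit) => V (x + s) y a b) 0 ρ := rowMass_rowShift_zero hVrow s
  have hVs_col : ∀ y, (Summable fun u => rowFn (fun x y (a b : Unit) => V (x + s) y a b) 0 u y) ∧
      ∑' u, rowFn (fun x y (a b : Unit) => V (x + s) y a b) 0 u y ≤ ωV * Real.exp (-κ * l1 (y - c)) := by
    intro y
    obtain ⟨hs, hle⟩ := hVcol y
    have e' : (fun u => rowFn (fun x y (a b : Unit) => V (x + s) y a b) 0 u y) = (fun u => rowFn V 0 u y) ∘ (Equiv.addRight s) := by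
      funext u; simp [rowFn]
    rw [e']
    exact ⟨(Equiv.summable_iff _).2 hs, (Equiv.tsum_eq (Equiv.addRight s) (fun u => rowFn V 0 u y)).trans_le hle⟩
  exact totMass_sandwich hVs_row hVs_col (rowMass_colShift hB hθ t) hθ hθκ (colMass_diag (weight_le hω hκ)) (rows_diag hω)

/-- [folklore] **PIECE «SAME SIDE»** (the pieces of `jetCw ω Ṽ` with the weight next to the vertex): `V` with columns localised at `c`, a column weight
`ω` localised at `c′`, `0 ≤ θ < κ`: `TotMass (x z ↦ ω z·V (x+s) (z+t)) (ω_V·e^{κ|t|₁}·Ω·Zl 4 (κ−θ)·e^{−θ|c−c′|₁})`. -/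
theorem totMass_piece_same (hVrow : RowMass V 0 ρ)
    (hVcol : ∀ y, (Summable fun u => rowFn V 0 u y) ∧ ∑' u, rowFn V 0 u y ≤ ωV * Real.exp (-κ * l1 (y - c)))
    (hθ : 0 ≤ θ) (hθκ : θ < κ) (hω : ∀ z, |ω z| ≤ Ω * Real.exp (-κ * l1 (z - c'))) (s t : Site 4) :
    TotMass (fun x z (_ _ : Unit) => ω z * V (x + s) (z + t) () ())
      (ωV * Real.exp (κ * l1 t) * Ω * Zl 4 (κ - θ) * Real.exp (-θ * l1 (c - c'))) := by
  have hκ : 0 ≤ κ := hθ.trans hθκ.le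
  have hωV : 0 ≤ ωV := by
    obtain ⟨_, hle⟩ := hVcol c
    rw [sub_self, l1_zero, mul_zero, Real.exp_zero, mul_one] at hle
    exact (tsum_nonneg fun u => rowFn_nonneg _ _ _ _).trans hle
  have e : (fun x z (_ _ : Unit) => ω z * V (x + s) (z + t) () ())
      = comp (fun x z (a b : Unit) => V (x + s) (z + t) a b) (fun x z (_ _ : Unit) => if x = z then ω x else 0) := by
    rw [← mul_diag_right]
    funext x z a b
    rw [mul_comm]
  rw [e]
  have hVs_row : RowMass (fun x z (a b : Unit) => V (x + s) (z + t) a b) 0 (Real.exp (0 * l1 t) * ρ) :=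
    rowMass_colShift (rowMass_rowShift_zero hVrow s) le_rfl t
  exact totMass_touch hVs_row (cols_shift2 hVcol hκ hωV s t) hθ hθκ (colMass_diag (weight_le hω hκ)) (rows_diag hω)

variable {ω' : Site 4 → ℝ} {Ω' : ℝ}

/-- [folklore] **PIECE «TWO WEIGHTS AROUND A LEG»** (the pieces of `jetRCw ω ω′ B`): `|ω x| ≤ Ω·e^{−κ|x−c|₁}`, `|ω′ z| ≤ Ω′·e^{−κ|z−c′|₁}`,
`RowMass B θ M_B`, `0 ≤ θ < κ`: `TotMass (x z ↦ ω x·ω′ z·B (x+s) (z+t)) (Ω·Ω′·(e^{θ|t|₁}·(e^{θ|s|₁}·M_B))·Zl 4 (κ−θ)·e^{−θ|c−c′|₁})`. -/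
theorem totMass_piece_rc (hω : ∀ x, |ω x| ≤ Ω * Real.exp (-κ * l1 (x - c))) (hω' : ∀ z, |ω' z| ≤ Ω' * Real.exp (-κ * l1 (z - c')))
    (hB : RowMass B θ MB) (hθ : 0 ≤ θ) (hθκ : θ < κ) (s t : Site 4) :
    TotMass (fun x z (_ _ : Unit) => ω x * ω' z * B (x + s) (z + t) () ())
      (Ω * Ω' * (Real.exp (θ * l1 t) * (Real.exp (θ * l1 s) * MB)) * Zl 4 (κ - θ) * Real.exp (-θ * l1 (c - c'))) := by
  have hκ : 0 ≤ κ := hθ.trans hθκ.le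
  have e : (fun x z (_ _ : Unit) => ω x * ω' z * B (x + s) (z + t) () ())
      = comp (comp (fun x z (_ _ : Unit) => if x = z then ω x else 0) (fun x z (a b : Unit) => B (x + s) (z + t) a b))
          (fun x z (_ _ : Unit) => if x = z then ω' x else 0) := by
    rw [← mul_diag_left, ← mul_diag_right]
    funext x z a b
    ring
  rw [e]
  have hBst : RowMass (fun x z (a b : Unit) => B (x + s) (z + t) a b) θ (Real.exp (θ * l1 t) * (Real.exp (θ * l1 s) * MB)) :=
    rowMass_colShift (rowMass_rowShift hB hθ s) hθ t
  exact totMass_sandwich (rowMass_diag (weight_le hω hκ)) (cols_diag hω) hBst hθ hθκ (colMass_diag (weight_le hω' hκ)) (rows_diag hω')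

/-- [folklore] **PIECE «ONE SUMMABLE WEIGHT ON A LEG»** (the pieces of `jetCw (w·w′) B`): `ColMass B 0 c_B`, `Σ'|ϖ| < ∞`:
`TotMass (x z ↦ ϖ z·B (x+s) (z+t)) (c_B·Σ'_z |ϖ z|)`. -/
theorem totMass_piece_summable {ϖ : Site 4 → ℝ} {cB : ℝ} (hB : ColMass B 0 cB) (hϖ : Summable fun z => |ϖ z|) (s t : Site 4) :
    TotMass (fun x z (_ _ : Unit) => ϖ z * B (x + s) (z + t) () ()) (cB * ∑' z, |ϖ z|) := by
  have e : (fun x z (_ _ : Unit) => ϖ z * B (x + s) (z + t) () ())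
      = comp (fun x z (a b : Unit) => B (x + s) (z + t) a b) (fun x z (_ _ : Unit) => if x = z then ϖ x else 0) := by
    rw [← mul_diag_right]
    funext x z a b
    rw [mul_comm]
  rw [e]
  exact totMass_comp_left (colMass_shift2_zero hB s t) (totMass_diag hϖ)

end Pieces

end Summit.QuantumFields.BalabanUV.Beta.D1BFx.CoframeWordPieces

end
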